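import Literature.Probability.RandomPlanarGeometry.HexSAWPolygonCellsRoof
import HarnessLib

/-!
# Cell calculus for honeycomb polygon surgery, XIII: the RUN LENGTH below the top hexagon and the ROOF IMAGE as functions

Topic `Literature/Probability/RandomPlanarGeometry` (lane «pcv-sawmu», a-p4 g21; sequel of `HexSAWPolygonCellsRoof.lean`).

To turn the roof move of part II into a FUNCTION of the cell set (as the map `E` of the step-two injection «OMEGA»,
`HOME/pub-sawmu-a-p4/g21/omega/THEOREM-OMEGA-g21.md` §2, requires) one needs the run length `k` = the least `i` with `e_i = (t.x + 2i + 1,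
t.y − 1) ∉ S`.  It exists because `S` is finite (`exists_runCell_notMem`); `runLen S t := Nat.find …` then satisfies `e_i ∈ S` for `i < runLen`
and `e_{runLen} ∉ S` (`runCell_mem_of_lt_runLen`, `runCell_runLen_notMem`), and `roofImage S t := S ∪ roof t (runLen S t)` is the roof image
with `perim (roofImage S t) = perim S + 2` whenever `LR t ∈ S` (`perim_roofImage`, from part II).  The flip image `flipImage S t := insert (UL t) S`
is recorded alongside (`perim_flipImage`), so that `E` on a cell set with top `t` reads: `flipImage` if `L t ∈ S`, else `roofImage` if `LR t ∈ S`.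

Sources: N. Madras, G. Slade, *The Self-Avoiding Walk* (1993), §3.2, proof of Theorem 3.2.3 [MadrasSlade1993]; I. Jensen, J. Phys.: Conf.
Ser. 42 (2006) 163 [Jensen2006HoneycombPolygons].  Label (lane): LANE INFRASTRUCTURE; nothing new in writing.
-/

open Finset

namespace Literature.Probability.RandomPlanarGeometry.SAW

namespace HexCell

/-- `runCell t` is injective. [cite: MadrasSlade1993, §3.2 (proof of Theorem 3.2.3)] -/
theorem runCell_injective (t : Cell) : Function.Injective (runCell t) := by
  intro i j h
  have := congrArg Prod.fst h
  simp only [runCell_fst] at this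
  omega

/-- Some `e_i` is missing (the set is finite). [cite: MadrasSlade1993, §3.2 (proof of Theorem 3.2.3)] -/
theorem exists_runCell_notMem (S : Finset Cell) (t : Cell) : ∃ i : ℕ, runCell t i ∉ S := by
  by_contra h
  push Not at h
  have hinj : Set.InjOn (runCell t) (Set.univ : Set ℕ) := fun i _ j _ e => runCell_injective t e
  have : (Set.univ : Set ℕ).Finite :=
    Set.Finite.of_finite_image (Set.Finite.subset S.finite_toSet (by rintro _ ⟨i, -, rfl⟩; exact h i)) hinj
  exact Set.infinite_univ this

open Classical in
/-- **The run length** `k`: the least `i` with `e_i ∉ S`. [cite: MadrasSlade1993, §3.2 (proof of Theorem 3.2.3)] -/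
noncomputable def runLen (S : Finset Cell) (t : Cell) : ℕ := Nat.find (exists_runCell_notMem S t)

open Classical in
/-- `e_{runLen} ∉ S`. [cite: MadrasSlade1993, §3.2 (proof of Theorem 3.2.3)] -/
theorem runCell_runLen_notMem (S : Finset Cell) (t : Cell) : runCell t (runLen S t) ∉ S :=
  Nat.find_spec (exists_runCell_notMem S t)

open Classical in
/-- `e_i ∈ S` for `i < runLen`. [cite: MadrasSlade1993, §3.2 (proof of Theorem 3.2.3)] -/
theorem runCell_mem_of_lt_runLen {S : Finset Cell} {t : Cell} {i : ℕ} (hi : i < runLen S t) : runCell t i ∈ S := by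
  have := Nat.find_min (exists_runCell_notMem S t) hi
  simpa using this

open Classical in
/-- `runLen ≥ 1` iff `LR t = e_0 ∈ S`. [cite: MadrasSlade1993, §3.2 (proof of Theorem 3.2.3)] -/
theorem one_le_runLen_iff {S : Finset Cell} {t : Cell} : 1 ≤ runLen S t ↔ LR t ∈ S := by
  have e0 : runCell t 0 = LR t := by ext <;> simp [LR]
  constructor
  · intro h; rw [← e0]; exact runCell_mem_of_lt_runLen h
  · intro h
    by_contra h0
    have hz : runLen S t = 0 := by omega
    have := runCell_runLen_notMem S t
    rw [hz, e0] at this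
    exact this h

/-- **The roof image** `S ∪ roof t (runLen S t)`. [cite: MadrasSlade1993, §3.2 (proof of Theorem 3.2.3)] -/
noncomputable def roofImage (S : Finset Cell) (t : Cell) : Finset Cell := S ∪ roof t (runLen S t)

/-- **The flip image** `insert (UL t) S`. [cite: MadrasSlade1993, §3.2 (proof of Theorem 3.2.3)] -/
def flipImage (S : Finset Cell) (t : Cell) : Finset Cell := insert (UL t) S

/-- ★ The roof image is a `+2` image when `LR t ∈ S` (class Y⋆ / type R at the top hexagon `t`).
[cite: MadrasSlade1993, §3.2, Theorem 3.2.3 (3.2.3) and its proof, transplanted to `ℍ`] -/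
theorem perim_roofImage {S : Finset Cell} {t : Cell} (h : IsLexmax S t) (hLR : LR t ∈ S) :
    perim (roofImage S t) = perim S + 2 :=
  perim_union_roof_of_isLexmax h (one_le_runLen_iff.2 hLR) (fun _ hi => runCell_mem_of_lt_runLen hi) (runCell_runLen_notMem S t)

/-- The roof image has `#S + runLen` hexagons. [cite: MadrasSlade1993, §3.2 (proof of Theorem 3.2.3)] -/
theorem card_roofImage {S : Finset Cell} {t : Cell} (h : IsLexmax S t) : #(roofImage S t) = #S + runLen S t :=
  card_union_roof_of_isLexmax h _

/-- ★ The flip image is a `+2` image when `L t ∈ S` (class X at the top hexagon `t`). [cite: MadrasSlade1993, §3.2, Theorem 3.2.3 (3.2.3)] -/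
theorem perim_flipImage {S : Finset Cell} {t : Cell} (h : IsLexmax S t) (hL : L t ∈ S) : perim (flipImage S t) = perim S + 2 :=
  perim_insert_ul_of_isLexmax h hL

/-- The flip image has `#S + 1` hexagons. [cite: MadrasSlade1993, §3.2 (proof of Theorem 3.2.3)] -/
theorem card_flipImage {S : Finset Cell} {t : Cell} (h : IsLexmax S t) : #(flipImage S t) = #S + 1 := by
  rw [flipImage, card_insert_of_notMem h.ul_notMem]

/-- The source sits inside both images. [cite: MadrasSlade1993, §3.2 (proof of Theorem 3.2.3)] -/
theorem subset_roofImage (S : Finset Cell) (t : Cell) : S ⊆ roofImage S t := subset_union_left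
/-- [cite: MadrasSlade1993, §3.2 (proof of Theorem 3.2.3)] -/
theorem subset_flipImage (S : Finset Cell) (t : Cell) : S ⊆ flipImage S t := subset_insert _ _

/-- The new top hexagon of the roof image is `a_{k−1}` (`k = runLen ≥ 1`). [cite: MadrasSlade1993, §3.2 (proof of Theorem 3.2.3)] -/
theorem isLexmax_roofImage {S : Finset Cell} {t : Cell} (h : IsLexmax S t) (hLR : LR t ∈ S) :
    IsLexmax (roofImage S t) (roofCell t (runLen S t - 1)) := by
  have hk := one_le_runLen_iff.2 hLR
  obtain ⟨j, hj⟩ : ∃ j, runLen S t = j + 1 := ⟨runLen S t - 1, by omega⟩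
  rw [hj, Nat.add_sub_cancel]
  refine ⟨mem_union_right _ (mem_roof.2 ⟨j, by omega, rfl⟩), fun c hc => ?_⟩
  rcases mem_union.1 hc with hc | hc
  · rcases h.2 c hc with h1 | ⟨h1, h2⟩
    · left; simpa using h1
    · right; simp only [roofCell_fst, roofCell_snd]; constructor <;> omega
  · obtain ⟨i, hi, rfl⟩ := mem_roof.1 hc
    right; simp only [roofCell_fst, roofCell_snd]; constructor
    · trivial
    · omega

/-- The new top hexagon of the flip image is `UL t`. [cite: MadrasSlade1993, §3.2 (proof of Theorem 3.2.3)] -/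
theorem isLexmax_flipImage {S : Finset Cell} {t : Cell} (h : IsLexmax S t) : IsLexmax (flipImage S t) (UL t) := by
  refine ⟨mem_insert_self _ _, fun c hc => ?_⟩
  rcases mem_insert.1 hc with rfl | hc
  · right; simp
  · rcases h.2 c hc with h1 | ⟨h1, -⟩
    · left; simp; omega
    · left; simp; omega

end HexCell

end Literature.Probability.RandomPlanarGeometry.SAW
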